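import Summits.HodgeConjecture.FermatCycles.ConditionQFourfoldSearch
import Summits.HodgeConjecture.FermatCycles.ConditionQFourfoldNinetySixTable
import HarnessLib

/-!
# Shioda's stable-generation condition `(Q⁴ₘ)` at `m = 96` — kernel certificate (part F of 10)

HONEST FRAMING: explicit algebraic cycles for specific Hodge classes on Fermat/Delsarte varieties;
residual open instances listed; no claim on general Hodge.

Topic path `Summits/HodgeConjecture/FermatCycles/` of cell `pub-hfermat` (new work, not literature: a computer determination of the cell —
`pub-hfermat-enum/P4-TABLE.md` §(Q⁴ₘ), two implementations — certified by the Lean kernel). Framework: `ConditionQFourfold.lean`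
(certificate Booleans, searches `checkQU`/`checkQN`) and `ConditionQFourfoldSearch.lean` (`conditionQ_four_of_normalized`).

THE STATEMENT. Shioda, Math. Ann. 245 (1979) §4 p. 183: `(Qⁿₘ)` — every element of `Mₘ(y)`, `3 ≤ y ≤ n/2 + 1`, is `ξ₁ − ξ₂` with
`ξ₁, ξ₂ ∈ M'ₘ = ⟨Mₘ(1), Mₘ(2), Mₘ(3)^sd⟩` (pairs, Hodge classes of the Fermat surface, semi-decomposable sextuples); by his Claim
(p. 183, Lemmas 2–3) `(Qⁿₘ)` may replace `(Pⁿₘ)` in Theorem III (`⇒` the Hodge conjecture for `Xⁿₘ`); p. 184: "we do not know any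
value of `m` which satisfies `(Qₘ)` but not `(Pₘ)`". Tree: `Literature.AlgebraicGeometry.Shioda1979.ConditionQ m n`, `MPrime`,
`forall_of_conditionQ` (the Claim's arithmetic spine), `ConditionP` (Math. Ann. form of `(P)`), `FermatCharacter.ShiodaConditionUpTo`
(Proc. Japan Acad. form, with the semi-decomposable alternative).

WHAT IS PROVED HERE (level `m = 96`, part F).
* part F of 10: the kernel searches `checkQN 96 T 10 2`, `checkQN 96 T 12 2` (170212 tuples);

NUMBERS (this seat's search `code/lit/q4/q4norm.py` = implementation 2; implementation 1 = ENUM `code/enum/q4table.py`,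
`data/shioda_Q4_m3-100.json`): case U visits 343692 sorted tuples and case N 921695; 13393 of them are Hodge sextuples; all but 192 carry a
`(P)`-witness (case N pair 10208, case N quasi 1194, case N semi 218, case U pair 1497, case U quasi 81, case U semi 3); the other 192 — `(1, 6, 15, 79, 93, 94)` (case U); `(1, 14, 49, 66, 68, 90)` (case U); `(1, 15, 34, 66, 79, 93)` (case U); `(1, 15, 51, 62, 65, 94)` (case U); `(1, 15, 51, 65, 66, 90)` (case U); `(1, 17, 49, 65, 66, 90)` (case U); `(1, 25, 49, 52, 73, 88)` (case U); `(1, 25, 49, 64, 73, 76)` (case U); `(1, 25, 49, 68, 72, 73)` (case U); `(1, 30, 33, 51, 79, 94)` (case U); `(1, 33, 34, 49, 81, 90)` (case U); `(1, 33, 34, 51, 79, 90)` (case U); `(1, 34, 36, 49, 78, 90)` (case U); `(1, 34, 45, 49, 66, 93)` (case U); `(1, 34, 49, 54, 66, 84)` (case U); `(1, 34, 49, 54, 72, 78)` (case U); `(2, 12, 14, 78, 90, 92)` (case N); `(2, 14, 27, 75, 78, 92)` (case N); `(2, 14, 33, 68, 81, 90)` (case N); `(2, 14, 36, 68, 78,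 90)` (case N); `(2, 14, 39, 54, 87, 92)` (case N); `(2, 14, 45, 66, 68, 93)` (case N); `(2, 14, 54, 60, 66, 92)` (case N); `(2, 14, 54, 66, 68, 84)` (case N); `(2, 26, 50, 56, 74, 80)` (case N); `(2, 27, 34, 72, 75, 78)` (case N); `(2, 28, 34, 54, 78, 92)` (case N); `(2, 32, 34, 54, 78, 88)` (case N); `(2, 32, 38, 50, 80, 86)` (case N); `(2, 33, 34, 45, 81, 93)` (case N); `(2, 33, 34, 54, 81, 84)` (case N); `(2, 34, 36, 45, 78, 93)` (case N); `(2, 34, 36, 50, 82, 84)` (case N); `(2, 34, 36, 54, 78, 84)` (case N); `(2, 34, 39, 54, 72, 87)` (case N); `(2, 34, 44, 54, 76, 78)` (case N); `(2, 34, 48, 54, 72, 78)` (case N); `(2, 34, 54, 56, 64, 78)` (case N); `(3, 10, 51, 70, 76, 78)` (case N); `(3, 10, 51, 72, 74, 78)` (case N); `(3, 15, 51, 62, 63, 94)` (case N); `(3, 18, 51, 60, 62, 94)` (case N); `(3, 27, 51, 60, 72, 75)` (case N); `(3, 28, 30, 51, 82, 94)` (case N); `(3, 30, 50, 51, 62,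 92)` (case N); `(3, 30, 50, 51, 72, 82)` (case N); `(3, 38, 39, 51, 70, 87)` (case N); `(3, 38, 44, 51, 74, 78)` (case N); `(3, 38, 51, 60, 66, 70)` (case N); `(4, 6, 18, 82, 84, 94)` (case N); `(4, 9, 42, 57, 82, 94)` (case N); `(4, 14, 46, 66, 68, 90)` (case N); `(4, 18, 21, 69, 82, 94)` (case N); `(4, 18, 22, 68, 86, 90)` (case N); `(4, 18, 42, 62, 68, 94)` (case N); `(4, 18, 42, 66, 68, 90)` (case N); `(4, 30, 36, 42, 82, 94)` (case N); `(4, 33, 34, 46, 81, 90)` (case N); `(4, 34, 36, 46, 78, 90)` (case N); `(4, 34, 45, 46, 66, 93)` (case N); `(4, 34, 46, 54, 66, 84)` (case N); `(4, 38, 42, 66, 68, 70)` (case N); `(6, 9, 50, 57, 82, 84)` (case N); `(6, 10, 28, 74, 78, 92)` (case N); `(6, 10, 32, 74, 78, 88)` (case N); `(6, 10, 33, 74, 81, 84)` (case N); `(6, 10, 36, 74, 78, 84)` (case N); `(6, 10, 39, 70, 76, 87)` (case N); `(6, 10, 39, 72, 74, 87)` (case N); `(6, 10, 44, 74, 76,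 78)` (case N); `(6, 10, 48, 72, 74, 78)` (case N); `(6, 10, 52, 66, 70, 84)` (case N); `(6, 10, 56, 64, 74, 78)` (case N); `(6, 10, 60, 66, 70, 76)` (case N); `(6, 15, 28, 63, 82, 94)` (case N); `(6, 15, 50, 62, 63, 92)` (case N); `(6, 15, 50, 63, 72, 82)` (case N); `(6, 18, 28, 60, 82, 94)` (case N); `(6, 18, 50, 60, 62, 92)` (case N); `(6, 18, 50, 62, 68, 84)` (case N); `(6, 20, 38, 66, 74, 84)` (case N); `(6, 28, 30, 50, 82, 92)` (case N); `(6, 28, 30, 54, 78, 92)` (case N); `(6, 30, 32, 50, 82, 88)` (case N); `(6, 30, 32, 54, 78, 88)` (case N); `(6, 30, 36, 50, 82, 84)` (case N); `(6, 30, 44, 50, 76, 82)` (case N); `(6, 30, 44, 54, 76, 78)` (case N); `(6, 30, 48, 50, 72, 82)` (case N); `(6, 30, 50, 56, 64, 82)` (case N); `(6, 30, 54, 56, 64, 78)` (case N); `(6, 38, 39, 44, 74, 87)` (case N); `(6, 38, 44, 60, 66, 74)` (case N); `(8, 14, 38, 62, 80, 86)` (case N); `(8, 14, 46, 64, 66,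 90)` (case N); `(8, 18, 22, 64, 86, 90)` (case N); `(8, 18, 42, 62, 64, 94)` (case N); `(8, 18, 42, 64, 66, 90)` (case N); `(8, 38, 42, 64, 66, 70)` (case N); `(9, 20, 26, 57, 86, 90)` (case N); `(9, 21, 50, 57, 69, 82)` (case N); `(9, 22, 24, 57, 86, 90)` (case N); `(9, 22, 52, 57, 58, 90)` (case N); `(9, 24, 33, 57, 81, 84)` (case N); `(9, 24, 42, 57, 62, 94)` (case N); `(9, 26, 45, 57, 58, 93)` (case N); `(9, 26, 54, 57, 58, 84)` (case N); `(9, 42, 50, 57, 62, 68)` (case N); `(10, 12, 42, 70, 76, 78)` (case N); `(10, 16, 34, 58, 82, 88)` (case N); `(10, 16, 46, 58, 64, 94)` (case N); `(10, 21, 33, 69, 74, 81)` (case N); `(10, 21, 36, 69, 74, 78)` (case N); `(10, 21, 52, 66, 69, 70)` (case N); `(10, 26, 36, 58, 74, 84)` (case N); `(10, 33, 42, 52, 70, 81)` (case N); `(10, 36, 42, 52, 70, 78)` (case N); `(12, 14, 39, 46, 87, 90)` (case N); `(12, 14, 46, 60, 62, 94)` (case N); `(12, 14, 46, 60, 66,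 90)` (case N); `(12, 15, 22, 63, 86, 90)` (case N); `(12, 15, 39, 63, 72, 87)` (case N); `(12, 15, 42, 62, 63, 94)` (case N); `(12, 18, 22, 60, 86, 90)` (case N); `(12, 18, 42, 60, 62, 94)` (case N); `(12, 22, 30, 58, 76, 90)` (case N); `(12, 22, 38, 60, 70, 86)` (case N); `(12, 26, 30, 44, 86, 90)` (case N); `(12, 28, 30, 42, 82, 94)` (case N); `(12, 28, 34, 46, 78, 90)` (case N); `(12, 30, 42, 50, 62, 92)` (case N); `(12, 38, 39, 42, 70, 87)` (case N); `(12, 38, 42, 44, 74, 78)` (case N); `(12, 38, 42, 60, 66, 70)` (case N); `(14, 20, 46, 52, 66, 90)` (case N); `(14, 24, 33, 46, 81, 90)` (case N); `(14, 24, 45, 46, 66, 93)` (case N); `(14, 24, 46, 48, 66, 90)` (case N); `(14, 26, 32, 62, 74, 80)` (case N); `(14, 27, 39, 46, 75, 87)` (case N); `(14, 27, 46, 60, 66, 75)` (case N); `(14, 32, 40, 46, 66, 90)` (case N); `(15, 22, 27, 63, 75, 86)` (case N); `(15, 22, 54, 58, 63, 76)` (case N); `(15, 26, 44, 54, 63,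 86)` (case N); `(15, 26, 54, 58, 63, 72)` (case N); `(16, 22, 34, 64, 70, 82)` (case N); `(16, 22, 40, 46, 70, 94)` (case N); `(18, 20, 22, 52, 86, 90)` (case N); `(18, 20, 26, 45, 86, 93)` (case N); `(18, 20, 26, 54, 84, 86)` (case N); `(18, 20, 42, 52, 62, 94)` (case N); `(18, 20, 42, 52, 66, 90)` (case N); `(18, 21, 24, 62, 69, 94)` (case N); `(18, 21, 50, 62, 68, 69)` (case N); `(18, 22, 24, 45, 86, 93)` (case N); `(18, 22, 24, 48, 86, 90)` (case N); `(18, 22, 27, 60, 75, 86)` (case N); `(18, 22, 32, 40, 86, 90)` (case N); `(18, 22, 45, 52, 58, 93)` (case N); `(18, 22, 52, 54, 58, 84)` (case N); `(18, 22, 54, 58, 60, 76)` (case N); `(18, 24, 42, 48, 62, 94)` (case N); `(18, 26, 44, 54, 60, 86)` (case N); `(18, 32, 40, 42, 62, 94)` (case N); `(18, 32, 40, 42, 66, 90)` (case N); `(20, 21, 38, 66, 69, 74)` (case N); `(20, 26, 30, 36, 86, 90)` (case N); `(20, 33, 38, 42, 74, 81)` (case N); `(20, 36, 38, 42, 74,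 78)` (case N); `(20, 38, 42, 52, 66, 70)` (case N); `(21, 24, 36, 45, 69, 93)` (case N); `(21, 24, 38, 66, 69, 70)` (case N); `(21, 30, 36, 50, 69, 82)` (case N); `(22, 27, 30, 58, 75, 76)` (case N); `(22, 30, 36, 52, 58, 90)` (case N); `(24, 33, 38, 42, 70, 81)` (case N); `(24, 38, 42, 48, 66, 70)` (case N); `(26, 27, 30, 44, 75, 86)` (case N); `(26, 27, 30, 58, 72, 75)` (case N); `(26, 28, 30, 54, 58, 92)` (case N); `(26, 30, 32, 54, 58, 88)` (case N); `(26, 30, 36, 45, 58, 93)` (case N); `(26, 30, 36, 54, 58, 84)` (case N); `(26, 30, 44, 54, 58, 76)` (case N); `(26, 30, 48, 54, 58, 72)` (case N); `(26, 30, 54, 56, 58, 64)` (case N); `(27, 28, 34, 46, 75, 78)` (case N); `(28, 34, 39, 46, 54, 87)` (case N); `(28, 34, 46, 54, 60, 66)` (case N); `(30, 36, 42, 50, 62, 68)` (case N); `(32, 38, 40, 42, 66, 70)` (case N) — carry the table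
certificate(s) written out in the statements below (generators checked by `genB`, the identity `s + ΣX = ΣY` by `decide`, all inside the kernel search).

PRINT STATUS (lit seat, 2026-08-20). `96 = 2⁵·3`: HC for every `Xⁿ₉₆` IS in print (Aoki 2000 Thm 0.1 (i), p. 185). The point of this level is Shioda's QUESTION (p. 184): `(Q⁴₉₆)` holds while `(P⁴₉₆)` fails; `96` has the largest certificate table of the twenty levels (192 sextuples without a `(P)`-witness; cell table, two implementations; kernel here).

References: [Shioda1979HodgeFermat] T. Shioda, Math. Ann. 245 (1979) 175–184, §3 p. 180 (`(Pⁿₘ)`), §4 pp. 183–184 (`M'ₘ`, `(Qⁿₘ)`, Claim,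
the question); [Shioda1979PJA] T. Shioda, Proc. Japan Acad. 55A (1979) §1 (Definition (i)–(iii), `(Pⁿₘ)'`); [daSilva2021HodgeFermat]
G. da Silva Jr., Experimental Results 2 (2021) e22, Def. 2.4, Question 1; [Aoki2000FermatTypeRemarks] N. Aoki, Comment. Math. Univ.
St. Pauli 49 (2000), Thm 0.1. Cell: `pub-hfermat-enum/P4-TABLE.md`, `data/shioda_Q4_m3-100.json`, `code/lit/q4/` (this seat).
-/

namespace Summit.HodgeConjecture.FermatCycles.ConditionQFourfold

open Multiset
open Literature.AlgebraicGeometry.HodgeTheory Literature.AlgebraicGeometry.HodgeTheory.FermatCharacter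
open Literature.AlgebraicGeometry.Shioda1982 Literature.AlgebraicGeometry.Shioda1979
open Summit.HodgeConjecture.FermatCycles.ShiodaConditionFourfold

/-! ### Level `96` — part F -/

/-! The certificate table at level `96` is the definition `table96` of `ConditionQFourfoldNinetySixTable.lean` (192 entries `(key, X, Y)`,
`s + ΣX = ΣY`; found by `code/lit/q4/q4norm.py`, every entry checked by the kernel inside the searches). -/

set_option maxHeartbeats 0 in
/-- The `(Q)`-search at level `96`, case N, first free representative in `[10, 12)` (87204 tuples). Kernel.
[cite: Shioda1979HodgeFermat, §4 condition (Qⁿₘ), p. 183] -/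
theorem checkQN_96_10 :
    checkQN 96
      table96
      10 2 = true := by
  decide +kernel

set_option maxHeartbeats 0 in
/-- The `(Q)`-search at level `96`, case N, first free representative in `[12, 14)` (83008 tuples). Kernel.
[cite: Shioda1979HodgeFermat, §4 condition (Qⁿₘ), p. 183] -/
theorem checkQN_96_12 :
    checkQN 96
      table96
      12 2 = true := by
  decide +kernel

end Summit.HodgeConjecture.FermatCycles.ConditionQFourfold
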